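import Literature.NumberTheory.LFunctions.RudnickSarnakNMainTerm
import Literature.NumberTheory.LFunctions.RudnickSarnakPairCount
import HarnessLib

/-!
# Rudnick–Sarnak `n`-level correlations for `ζ`: clustering of zeros at scale `1/log T`

Sibling file of `Literature/NumberTheory/LFunctions/RudnickSarnak.lean` (toward
`Literature.NumberTheory.LFunctions.rudnick_sarnak_unrestricted`, Rudnick–Sarnak 1996, Theorem 3.2
for `ζ`, at every level). This file belongs to the *back end* of the programme (the passage from
the smoothed, `t`-windowed sums `W(T) = RudnickSarnakN.zeroSideSum Φ T` of
`RudnickSarnakNSliceSum.lean` to the sharp sums `C_n(f, T)` of (3.2); Rudnick–Sarnak 1996,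
pp. 302–304). The one arithmetic input of that passage is an *a priori* bound for the number of
`n`-tuples of zeros clustered at the scale `1/log T` of the mean spacing:

  `#{(γ_0, …, γ_k) : 0 < γ_0 ≤ T, |γ_i − γ_0| ≤ 2πy/log T (1 ≤ i ≤ k)} ≤ C y^k T log T`

for `T ≥ T₀`, uniformly in `1 ≤ y ≤ 3 log T/2π` (`RudnickSarnakN.Unsmooth.exists_card_cluster_le`;
zeros counted with multiplicity, under RH). At level `2` this is the Fejér-kernel corollary of
Montgomery's theorem (`RudnickSarnak.exists_pairCount_window_le`); at level `n` it is obtained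
here, in the manner of Rudnick–Sarnak's majorant argument (p. 303: "we can find a majorant `Φ₊`
… admissible in Theorem 3.1 … and we can bound the sum by `O(TL)`"), from the **uniform sieve
upper bound** of the front end (`RudnickSarnakN.norm_integral_patternSum_le`,
`RudnickSarnakN.norm_slotIntegral_sub_patternSum_le`):

* `RudnickSarnakN.Unsmooth.norm_zeroSideSum_le` — `‖W_Φ(T)‖ ≤ C₁ M_Φ T log T + C₂ (log T + n + 4)^{3n+1} T^{1−δ/2} ‖Φ∘ξ‖₁`
  for every bounded (`‖Φ‖ ≤ M_Φ`) `Φ` integrable on the slice, supported in the box `|ξ_j| ≤ 2`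
  and, on the slice, in `Σ |ξ_j| ≤ 2 − δ` (no smoothness is needed);
* `RudnickSarnakN.Unsmooth.testPhi` — the positive test functions `Φ_y(ξ) = Π_{i} G_y(ξ_{i+1})`,
  `G_y(α) = s ψ(sα)`, `ψ = φ ⋆ φ` the Fejér-type pair of `RudnickSarnak.exists_posDef_testPair`,
  for which `f_{Φ_y}(x) = Π_i ψ̂((x_{i+1} − x_0)/s) ≥ 0` is `≥ c^k` on the window
  `|x_{i+1} − x_0| ≤ y` (`RudnickSarnakN.Unsmooth.rsPhiTest_testPhi`);
* the lower bound `W_{Φ_y}(T) ≥ c^k (κ(0)/2)^{n} · #{clustered tuples}` (positivity of every term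
  and `κ ≥ κ(0)/2` on `[−4, 4]`, `RudnickSarnakN.half_ker_zero_le`), whence the cluster bound.

## References

* Z. Rudnick, P. Sarnak, *Zeros of principal `L`-functions and random matrix theory*, Duke Math.
  J. 81 (1996), 269–322, Thm. 3.2 and pp. 302–304.
* D. A. Goldston, *Notes on pair correlation of zeros and prime numbers*, LMS LNS 322 (2005),
  §5 (the Fejér pair).
-/

noncomputable section

open Complex Filter Set MeasureTheory Finset
open scoped Real Topology FourierTransform

namespace Literature.NumberTheory.LFunctions

namespace RudnickSarnakN

namespace Unsmooth

variable {k : ℕ}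

/-! ## The windowed sum as the slice integral of `V_T`, and the sieve upper bound -/

/-- `W_Φ(T) = ∫_η Φ(ξ(η)) V_T(ξ(η)) dη` (files IX and X of the front end). [cite: RudnickSarnak1996, (3.11)] -/
theorem zeroSideSum_eq_integral_slotIntegral {Φ : (Fin (k + 1) → ℝ) → ℂ}
    (hΦ : Integrable fun η : Fin k → ℝ ↦ Φ (slicePt η)) {T : ℝ} (hT : 0 ≤ T) :
    zeroSideSum Φ T = ∫ η : Fin k → ℝ, Φ (slicePt η) * slotIntegral T (slicePt η) := by
  rw [zeroSideSum_eq_sliceIntegral hΦ hT, sliceIntegral_eq_integral_slotIntegral hΦ hT]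
  rfl

/-- `Φ · 𝔓_T` is integrable on the slice when `Φ` is. [folklore] -/
theorem integrable_phi_mul_patternSum {Φ : (Fin (k + 1) → ℝ) → ℂ}
    (hΦ : Integrable fun η : Fin k → ℝ ↦ Φ (slicePt η)) (T : ℝ) :
    Integrable fun η : Fin k → ℝ ↦ Φ (slicePt η) * patternSum T (slicePt η) := by
  have h : (fun η : Fin k → ℝ ↦ Φ (slicePt η) * patternSum T (slicePt η)) = fun η ↦
      ∑ D ∈ (Finset.univ : Finset (Fin (k + 1))).powerset, ∑ P ∈ (Finset.univ \ D).powerset,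
        cellCoef T D * (Φ (slicePt η) * ((densG T D η * cellDiag T D P η : ℝ) : ℂ)) :=
    funext (phi_mul_patternSum_eq Φ T)
  rw [h]
  exact integrable_finsetSum _ fun D _ ↦ integrable_finsetSum _ fun P _ ↦
    (integrable_phi_cellDiag hΦ T D P).const_mul _

/-- A uniform bound for `V_T(ξ(η))`: `‖V_T‖ ≤ B` on the slice, for `T ≥ 0`. [folklore] -/
theorem exists_norm_slotIntegral_le (k : ℕ) {T : ℝ} (hT : 0 ≤ T) :
    ∃ B : ℝ, 0 ≤ B ∧ ∀ ξ : Fin (k + 1) → ℝ, ‖slotIntegral T ξ‖ ≤ B := by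
  set D : ℝ → ℝ := fun t ↦ ∑' n : ℕ, ker (t - zetaOrdinate n)
  obtain ⟨B, hB⟩ : ∃ B : ℝ, ∀ t ∈ Icc 0 T, D t ^ (k + 1) ≤ B := by
    have hc : ContinuousOn (fun t ↦ D t ^ (k + 1)) (Icc 0 T) := (continuous_tsum_ker_sub.pow _).continuousOn
    obtain ⟨B, hB⟩ := (isCompact_Icc.image_of_continuousOn hc).isBounded.bddAbove
    exact ⟨B, fun t ht ↦ hB (Set.mem_image_of_mem _ ht)⟩
  have hB0 : 0 ≤ B := le_trans (pow_nonneg (tsum_nonneg fun n ↦ ker_nonneg _) _) (hB 0 ⟨le_rfl, hT⟩)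
  refine ⟨T * B, by positivity, fun ξ ↦ ?_⟩
  unfold slotIntegral
  have hbound : ∀ t ∈ Icc 0 T, ‖∏ j, zeroSumPlus (-(Real.log T * ξ j)) t‖ ≤ B := by
    intro t ht
    refine le_trans ?_ (hB t ht)
    rw [norm_prod, show D t ^ (k + 1) = ∏ _j : Fin (k + 1), D t by simp]
    exact Finset.prod_le_prod (fun j _ ↦ norm_nonneg _) fun j _ ↦ norm_zeroSumPlus_le _ _
  calc ‖∫ t in (0 : ℝ)..T, ∏ j, zeroSumPlus (-(Real.log T * ξ j)) t‖
      ≤ B * |T - 0| := intervalIntegral.norm_integral_le_of_norm_le_const fun t ht ↦ hbound t (by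
          rw [Set.uIoc_of_le hT] at ht; exact ⟨ht.1.le, ht.2⟩)
    _ = T * B := by rw [sub_zero, abs_of_nonneg hT, mul_comm]

/-- `η ↦ V_T(ξ(η))` is continuous. [folklore] -/
theorem continuous_slotIntegral_slicePt (k : ℕ) (T : ℝ) :
    Continuous fun η : Fin k → ℝ ↦ slotIntegral T (slicePt η) := by
  unfold slotIntegral
  exact intervalIntegral.continuous_parametric_intervalIntegral_of_continuous'
    (continuous_prod_zeroSumPlus_slice (Real.log T)) 0 T

/-- `Φ · V_T` is integrable on the slice when `Φ` is (`V_T` is continuous and bounded). [folklore] -/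
theorem integrable_phi_mul_slotIntegral {Φ : (Fin (k + 1) → ℝ) → ℂ}
    (hΦ : Integrable fun η : Fin k → ℝ ↦ Φ (slicePt η)) {T : ℝ} (hT : 0 ≤ T) :
    Integrable fun η : Fin k → ℝ ↦ Φ (slicePt η) * slotIntegral T (slicePt η) := by
  obtain ⟨B, -, hB⟩ := exists_norm_slotIntegral_le k hT
  exact Integrable.mul_bdd (c := B) hΦ (continuous_slotIntegral_slicePt k T).aestronglyMeasurable
    (Eventually.of_forall fun η ↦ hB _)

/-- **The uniform sieve upper bound for the windowed sums** (front end, files XI–XII; RH): there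
is `C = C(n, δ) ≥ 0` such that for all `T ≥ 3` and every `Φ` integrable on the slice, bounded by
`M_Φ`, supported in the box `|ξ_j| ≤ 2` and, on the slice, in `Σ_j |ξ_j| ≤ 2 − δ`,
`‖W_Φ(T)‖ ≤ unifConst(k) M_Φ T log T + C (log T + k + 5)^{3(k+1)+1} T^{1−δ/2} ∫_η ‖Φ(ξ(η))‖ dη`.
No smoothness of `Φ` is required. (Rudnick–Sarnak 1996, Thm. 3.1 with (3.49), used as an upper
bound as on p. 303.) [cite: RudnickSarnak1996, Thm. 3.1, (3.49)] -/
theorem norm_zeroSideSum_le (hRH : RiemannHypothesis) (k : ℕ) {δ : ℝ} (hδ : 0 < δ) :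
    ∃ C : ℝ, 0 ≤ C ∧ ∀ T : ℝ, 3 ≤ T → ∀ (Φ : (Fin (k + 1) → ℝ) → ℂ) (MΦ : ℝ),
      (Integrable fun η : Fin k → ℝ ↦ Φ (slicePt η)) → (∀ ξ, ‖Φ ξ‖ ≤ MΦ) →
      (∀ ξ, Φ ξ ≠ 0 → ∀ j, |ξ j| ≤ 2) →
      (∀ η : Fin k → ℝ, Φ (slicePt η) ≠ 0 → ∑ j, |slicePt η j| ≤ 2 - δ) →
        ‖zeroSideSum Φ T‖ ≤ unifConst k * MΦ * T * Real.log T +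
          C * (Real.log T + k + 5) ^ (3 * (k + 1) + 1) * T ^ (1 - δ / 2) * ∫ η : Fin k → ℝ, ‖Φ (slicePt η)‖ := by
  obtain ⟨C, hC0, hC⟩ := norm_slotIntegral_sub_patternSum_le hRH k hδ
  refine ⟨C, hC0, fun T hT Φ MΦ hΦi hΦb hΦs hΦδ ↦ ?_⟩
  have hT0 : (0 : ℝ) ≤ T := by linarith
  have hT2 : (2 : ℝ) ≤ T := by linarith
  set E : ℝ := C * (Real.log T + k + 5) ^ (3 * (k + 1) + 1) * T ^ (1 - δ / 2)
  have hE0 : 0 ≤ E := by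
    have hL : 0 ≤ Real.log T := Real.log_nonneg (by linarith)
    positivity
  have h1 := integrable_phi_mul_slotIntegral hΦi hT0
  have h2 := integrable_phi_mul_patternSum hΦi T
  rw [zeroSideSum_eq_integral_slotIntegral hΦi hT0]
  have h3 : Integrable fun η : Fin k → ℝ ↦
      Φ (slicePt η) * (slotIntegral T (slicePt η) - patternSum T (slicePt η)) := by
    have := h1.sub h2
    simp only [Pi.sub_def, ← mul_sub] at this
    exact this
  have hsplit : (∫ η : Fin k → ℝ, Φ (slicePt η) * slotIntegral T (slicePt η)) =
      (∫ η : Fin k → ℝ, Φ (slicePt η) * patternSum T (slicePt η)) +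
        ∫ η : Fin k → ℝ, Φ (slicePt η) * (slotIntegral T (slicePt η) - patternSum T (slicePt η)) := by
    rw [← integral_add h2 h3]
    congr 1 with η
    ring
  rw [hsplit]
  refine (norm_add_le _ _).trans (add_le_add (norm_integral_patternSum_le hT hΦi hΦb hΦs) ?_)
  -- the error integral
  have hpt : ∀ η : Fin k → ℝ, ‖Φ (slicePt η) * (slotIntegral T (slicePt η) - patternSum T (slicePt η))‖ ≤
      E * ‖Φ (slicePt η)‖ := by
    intro η
    by_cases h0 : Φ (slicePt η) = 0
    · simp [h0]
    · rw [norm_mul, mul_comm]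
      refine mul_le_mul_of_nonneg_right ?_ (norm_nonneg _)
      have hbox : ∀ j, |slicePt η j| ≤ 2 := hΦs _ h0
      exact hC T hT2 (slicePt η) hbox (sum_slicePt η) (hΦδ η h0)
  calc ‖∫ η : Fin k → ℝ, Φ (slicePt η) * (slotIntegral T (slicePt η) - patternSum T (slicePt η))‖
      ≤ ∫ η : Fin k → ℝ, E * ‖Φ (slicePt η)‖ :=
        norm_integral_le_of_norm_le (hΦi.norm.const_mul E) (Eventually.of_forall hpt)
    _ = E * ∫ η : Fin k → ℝ, ‖Φ (slicePt η)‖ := integral_const_mul _ _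

/-! ## An explicit form of the error term -/

/-- `(log T + k + 5)^{p} T^{1/2} ≤ C T log T` for `T ≥ 3` (`log T ≤ T^{ε}/ε`). [folklore] -/
theorem exists_errTerm_le (k : ℕ) :
    ∃ C : ℝ, 0 ≤ C ∧ ∀ T : ℝ, 3 ≤ T →
      (Real.log T + k + 5) ^ (3 * (k + 1) + 1) * T ^ (1 - (1 : ℝ) / 2) ≤ C * T * Real.log T := by
  set p : ℕ := 3 * (k + 1) + 1
  -- `log T ≤ T^{ε}/ε` with `ε = 1/(2(p-1))`, so `L^{p-1} ≤ (T^ε/ε)^{p-1} = ε^{-(p-1)} T^{1/2}`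
  set ε : ℝ := 1 / (2 * ((p : ℝ) - 1))
  have hp1 : (1 : ℝ) < p := by
    simp only [p]; push_cast; nlinarith [Nat.cast_nonneg (α := ℝ) k]
  have hε : 0 < ε := by simp only [ε]; exact div_pos one_pos (by linarith)
  refine ⟨((k : ℝ) + 6) ^ p * (1 / ε) ^ (p - 1), by positivity, fun T hT ↦ ?_⟩
  have hT0 : (0 : ℝ) < T := by linarith
  have hL1 : 1 ≤ Real.log T := by
    rw [Real.le_log_iff_exp_le hT0]
    exact le_trans (le_of_lt (lt_trans Real.exp_one_lt_d9 (by norm_num))) hT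
  have hL0 : 0 ≤ Real.log T := by linarith
  -- `L + k + 5 ≤ (k + 6) L`
  have h1 : Real.log T + k + 5 ≤ ((k : ℝ) + 6) * Real.log T := by nlinarith [Nat.cast_nonneg (α := ℝ) k]
  have h2 : (Real.log T + k + 5) ^ p ≤ ((k : ℝ) + 6) ^ p * Real.log T ^ p := by
    rw [← mul_pow]; exact pow_le_pow_left₀ (by positivity) h1 _
  -- `L^{p-1} ≤ (1/ε)^{p-1} T^{1/2}`
  have hlog : Real.log T ≤ T ^ ε / ε := Real.log_le_rpow_div hT0.le hε
  have hp0 : (p : ℝ) - 1 ≠ 0 := by linarith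
  have h3 : Real.log T ^ (p - 1) ≤ (1 / ε) ^ (p - 1) * T ^ (1 / 2 : ℝ) := by
    calc Real.log T ^ (p - 1) ≤ (T ^ ε / ε) ^ (p - 1) := pow_le_pow_left₀ hL0 hlog _
      _ = (1 / ε) ^ (p - 1) * (T ^ ε) ^ (p - 1) := by rw [div_eq_mul_one_div, mul_pow, mul_comm]
      _ = (1 / ε) ^ (p - 1) * T ^ (1 / 2 : ℝ) := by
          congr 1
          rw [← Real.rpow_natCast, ← Real.rpow_mul hT0.le]
          congr 1
          have : ((p - 1 : ℕ) : ℝ) = (p : ℝ) - 1 := by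
            rw [Nat.cast_sub (by omega)]; simp
          rw [this]; simp only [ε]
          field_simp
  have hpsplit : Real.log T ^ p = Real.log T * Real.log T ^ (p - 1) := by
    rw [← pow_succ', Nat.sub_add_cancel (by omega : 1 ≤ p)]
  have hhalf : T ^ (1 - (1 : ℝ) / 2) = T ^ (1 / 2 : ℝ) := by norm_num
  have hTT : T ^ (1 / 2 : ℝ) * T ^ (1 / 2 : ℝ) = T := by
    rw [← Real.rpow_add hT0]; norm_num
  rw [hhalf]
  calc (Real.log T + k + 5) ^ p * T ^ (1 / 2 : ℝ)
      ≤ ((k : ℝ) + 6) ^ p * Real.log T ^ p * T ^ (1 / 2 : ℝ) := mul_le_mul_of_nonneg_right h2 (by positivity)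
    _ = ((k : ℝ) + 6) ^ p * Real.log T * (Real.log T ^ (p - 1) * T ^ (1 / 2 : ℝ)) := by rw [hpsplit]; ring
    _ ≤ ((k : ℝ) + 6) ^ p * Real.log T * ((1 / ε) ^ (p - 1) * T ^ (1 / 2 : ℝ) * T ^ (1 / 2 : ℝ)) :=
        mul_le_mul_of_nonneg_left (mul_le_mul_of_nonneg_right h3 (by positivity)) (by positivity)
    _ = ((k : ℝ) + 6) ^ p * (1 / ε) ^ (p - 1) * T * Real.log T := by rw [mul_assoc _ _ (T ^ _), hTT]; ring

/-! ## The Fejér-type pair and the positive test functions -/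

/-- The Fejér-type pair of `RudnickSarnak.exists_posDef_testPair` (a continuous `ψ` supported in
`|α| ≤ 1/2` with `ψ̂ ≥ 0`, `ψ̂ ≥ c > 0` on `|y| ≤ y₀`), chosen once. [cite: Goldston2005, §5 (5.4)] -/
def psi : ℝ → ℂ := Classical.choose RudnickSarnak.exists_posDef_testPair

/-- The defining properties of `psi`. [cite: Goldston2005, §5 (5.4)] -/
theorem psi_spec : Continuous psi ∧ (∀ α, 1 / 2 < |α| → psi α = 0) ∧ (∀ y, (𝓕 psi y).im = 0) ∧
    (∀ y, 0 ≤ (𝓕 psi y).re) ∧ ∃ y₀ > 0, ∃ c > 0, ∀ y, |y| ≤ y₀ → c ≤ (𝓕 psi y).re :=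
  Classical.choose_spec RudnickSarnak.exists_posDef_testPair

/-- The radius `y₀` on which `ψ̂ ≥ c`. [folklore] -/
def psiY0 : ℝ := Classical.choose psi_spec.2.2.2.2

/-- `y₀ > 0` and `ψ̂ ≥ c > 0` on `|y| ≤ y₀`. [folklore] -/
theorem psiY0_spec : 0 < psiY0 ∧ ∃ c > 0, ∀ y, |y| ≤ psiY0 → c ≤ (𝓕 psi y).re :=
  Classical.choose_spec psi_spec.2.2.2.2

/-- The constant `c > 0` with `ψ̂ ≥ c` on `|y| ≤ y₀`. [folklore] -/
def psiC : ℝ := Classical.choose psiY0_spec.2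

/-- `c > 0` and `ψ̂ ≥ c` on `|y| ≤ y₀`. [folklore] -/
theorem psiC_spec : 0 < psiC ∧ ∀ y, |y| ≤ psiY0 → psiC ≤ (𝓕 psi y).re :=
  Classical.choose_spec psiY0_spec.2

/-- `ψ` is continuous. [folklore] -/
theorem continuous_psi : Continuous psi := psi_spec.1

/-- `ψ` vanishes on `|α| > 1/2`. [folklore] -/
theorem psi_eq_zero {α : ℝ} (h : 1 / 2 < |α|) : psi α = 0 := psi_spec.2.1 α h

/-- `ψ` has compact support (inside `[-1/2, 1/2]`). [folklore] -/
theorem hasCompactSupport_psi : HasCompactSupport psi := by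
  refine HasCompactSupport.of_support_subset_isCompact (isCompact_Icc (a := -(1 / 2 : ℝ)) (b := 1 / 2)) ?_
  intro α hα
  rw [Function.mem_support] at hα
  by_contra h
  rw [Set.mem_Icc, not_and_or, not_le, not_le] at h
  refine hα (psi_eq_zero ?_)
  rcases h with h | h
  · rw [abs_of_neg (by linarith)]; linarith
  · rw [abs_of_pos (by linarith)]; linarith

/-- `ψ` is integrable. [folklore] -/
theorem integrable_psi : Integrable psi := continuous_psi.integrable_of_hasCompactSupport hasCompactSupport_psi

/-- A bound `B_ψ ≥ ‖ψ‖_∞`. [folklore] -/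
def psiBound : ℝ := Classical.choose (continuous_psi.bounded_above_of_compact_support hasCompactSupport_psi)

/-- `‖ψ(α)‖ ≤ B_ψ`. [folklore] -/
theorem norm_psi_le (α : ℝ) : ‖psi α‖ ≤ psiBound :=
  Classical.choose_spec (continuous_psi.bounded_above_of_compact_support hasCompactSupport_psi) α

/-- `0 ≤ B_ψ`. [folklore] -/
theorem psiBound_nonneg : 0 ≤ psiBound := (norm_nonneg _).trans (norm_psi_le 0)

/-- The inner radius at level `k`: `y₁ = min(y₀, 1/(4(k+1)))`. [folklore] -/
def yOne (k : ℕ) : ℝ := min psiY0 (1 / (4 * ((k : ℝ) + 1)))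

/-- `0 < y₁`. [folklore] -/
theorem yOne_pos (k : ℕ) : 0 < yOne k := lt_min psiY0_spec.1 (by positivity)

/-- `y₁ ≤ y₀`. [folklore] -/
theorem yOne_le_psiY0 (k : ℕ) : yOne k ≤ psiY0 := min_le_left _ _

/-- `y₁ ≤ 1/(4(k+1))`. [folklore] -/
theorem yOne_le (k : ℕ) : yOne k ≤ 1 / (4 * ((k : ℝ) + 1)) := min_le_right _ _

/-- The dilation parameter `s = y/y₁` for the window `|u| ≤ y`. [folklore] -/
def scl (k : ℕ) (y : ℝ) : ℝ := y / yOne k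

/-- `0 < s` for `y > 0`. [folklore] -/
theorem scl_pos (k : ℕ) {y : ℝ} (hy : 0 < y) : 0 < scl k y := div_pos hy (yOne_pos k)

/-- The dilated pair `G(α) = s ψ(sα)`. [folklore] -/
def gDil (k : ℕ) (y : ℝ) (α : ℝ) : ℂ := (scl k y : ℂ) * psi (scl k y * α)

/-- `G` is continuous. [folklore] -/
theorem continuous_gDil (k : ℕ) (y : ℝ) : Continuous (gDil k y) :=
  continuous_const.mul (continuous_psi.comp (continuous_const.mul continuous_id))

/-- `G(α) = 0` unless `|α| ≤ 1/(2s) = y₁/(2y)`. [folklore] -/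
theorem gDil_eq_zero (k : ℕ) {y : ℝ} (hy : 0 < y) {α : ℝ} (hα : yOne k / (2 * y) < |α|) : gDil k y α = 0 := by
  unfold gDil
  rw [psi_eq_zero, mul_zero]
  rw [abs_mul, abs_of_pos (scl_pos k hy)]
  unfold scl
  have h1 : 0 < yOne k := yOne_pos k
  rw [div_mul_eq_mul_div, lt_div_iff₀ h1]
  rw [div_lt_iff₀ (by positivity)] at hα
  linarith

/-- `G(α) ≠ 0 ⟹ |α| ≤ y₁/(2y)`. [folklore] -/
theorem abs_le_of_gDil_ne_zero (k : ℕ) {y : ℝ} (hy : 0 < y) {α : ℝ} (h : gDil k y α ≠ 0) :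
    |α| ≤ yOne k / (2 * y) := by
  by_contra hlt
  exact h (gDil_eq_zero k hy (not_le.1 hlt))

/-- `‖G(α)‖ ≤ s B_ψ`. [folklore] -/
theorem norm_gDil_le (k : ℕ) {y : ℝ} (hy : 0 < y) (α : ℝ) : ‖gDil k y α‖ ≤ scl k y * psiBound := by
  unfold gDil
  rw [norm_mul, Complex.norm_real, Real.norm_of_nonneg (scl_pos k hy).le]
  exact mul_le_mul_of_nonneg_left (norm_psi_le _) (scl_pos k hy).le

/-- `G` is integrable. [folklore] -/
theorem integrable_gDil (k : ℕ) {y : ℝ} (hy : 0 < y) : Integrable (gDil k y) := by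
  unfold gDil
  exact ((integrable_psi.comp_mul_left' (scl_pos k hy).ne')).const_mul _

/-- `∫ ‖G‖ = ∫ ‖ψ‖`. [folklore] -/
theorem integral_norm_gDil (k : ℕ) {y : ℝ} (hy : 0 < y) : ∫ α, ‖gDil k y α‖ = ∫ α, ‖psi α‖ := by
  have hs := scl_pos k hy
  unfold gDil
  simp_rw [norm_mul, Complex.norm_real, Real.norm_of_nonneg hs.le]
  rw [integral_const_mul, Measure.integral_comp_mul_left (fun α ↦ ‖psi α‖) (scl k y)]
  rw [abs_of_pos (inv_pos.2 hs), smul_eq_mul, ← mul_assoc, mul_inv_cancel₀ hs.ne', one_mul]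

/-- The Fourier transform of the dilated pair: `∫ G(α) e(−uα) dα = ψ̂(u/s)`. [folklore] -/
theorem integral_gDil_mul_cexp (k : ℕ) {y : ℝ} (hy : 0 < y) (u : ℝ) :
    ∫ α : ℝ, gDil k y α * cexp (-(2 * π * I * (u * α : ℝ))) = 𝓕 psi (u / scl k y) := by
  have hs := scl_pos k hy
  set s := scl k y with hsdef
  set g : ℝ → ℂ := fun β ↦ psi β * cexp (-(2 * π * I * ((u / s) * β : ℝ))) with hgdef
  have hreal : ∀ α : ℝ, (u / s) * (s * α) = u * α := fun α ↦ by field_simp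
  have hpt : ∀ α : ℝ, gDil k y α * cexp (-(2 * π * I * (u * α : ℝ))) = (s : ℂ) * g (s * α) := by
    intro α
    simp only [hgdef, gDil, ← hsdef, hreal]
    ring
  simp_rw [hpt]
  rw [integral_const_mul, Measure.integral_comp_mul_left g s, abs_of_pos (inv_pos.2 hs), Complex.real_smul, ← mul_assoc,
    show (s : ℂ) * ((s⁻¹ : ℝ) : ℂ) = 1 by push_cast; exact mul_inv_cancel₀ (by exact_mod_cast hs.ne'), one_mul,
    Real.fourier_real_eq_integral_exp_smul]
  refine integral_congr_ae (Eventually.of_forall fun β ↦ ?_)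
  simp only [hgdef, smul_eq_mul]
  rw [mul_comm]
  congr 1
  congr 1
  push_cast
  ring

/-- The factor `F(u) = ψ̂(u/s)`: real, non-negative, and `≥ c` for `|u| ≤ y`. [folklore] -/
theorem fourier_psi_div_re_ge (k : ℕ) {y : ℝ} (hy : 0 < y) {u : ℝ} (hu : |u| ≤ y) :
    psiC ≤ (𝓕 psi (u / scl k y)).re := by
  refine psiC_spec.2 _ ?_
  have hs := scl_pos k hy
  rw [abs_div, abs_of_pos hs, div_le_iff₀ hs]
  unfold scl
  calc |u| ≤ y := hu
    _ = yOne k * (y / yOne k) := by field_simp [(yOne_pos k).ne']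
    _ ≤ psiY0 * (y / yOne k) := mul_le_mul_of_nonneg_right (yOne_le_psiY0 k) (div_pos hy (yOne_pos k)).le

/-- **The positive test function at level `n = k + 1` and window `y`**:
`Φ_y(ξ) = 1[|ξ_0| ≤ 2] Π_{i<k} G(ξ_{i+1})`. [cite: RudnickSarnak1996, p. 303 (the majorant `Φ₊`)] -/
def testPhi (k : ℕ) (y : ℝ) (ξ : Fin (k + 1) → ℝ) : ℂ :=
  if |ξ 0| ≤ 2 then ∏ i : Fin k, gDil k y (ξ i.succ) else 0

/-- If `Π_i G(η_i) ≠ 0` then every `|η_i| ≤ y₁/(2y)`. [folklore] -/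
theorem abs_le_of_prod_gDil_ne_zero {y : ℝ} (hy : 0 < y) {η : Fin k → ℝ}
    (h : ∏ i : Fin k, gDil k y (η i) ≠ 0) (i : Fin k) : |η i| ≤ yOne k / (2 * y) :=
  abs_le_of_gDil_ne_zero k hy (Finset.prod_ne_zero_iff.1 h i (Finset.mem_univ i))

/-- `y₁/(2y) ≤ 1/(8(k+1))` for `y ≥ 1`. [folklore] -/
theorem yOne_div_le {y : ℝ} (hy : 1 ≤ y) : yOne k / (2 * y) ≤ 1 / (8 * ((k : ℝ) + 1)) := by
  have h1 := yOne_le k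
  have h0 := (yOne_pos k).le
  calc yOne k / (2 * y) ≤ yOne k / 2 := by
        apply div_le_div_of_nonneg_left h0 (by norm_num) (by linarith)
    _ ≤ (1 / (4 * ((k : ℝ) + 1))) / 2 := by linarith
    _ = 1 / (8 * ((k : ℝ) + 1)) := by
        have hk : (k : ℝ) + 1 ≠ 0 := by positivity
        field_simp
        ring

/-- If `Π_i G(η_i) ≠ 0` and `y ≥ 1` then `Σ_i |η_i| ≤ 1/8`. [folklore] -/
theorem sum_abs_le_of_prod_gDil_ne_zero {y : ℝ} (hy : 1 ≤ y) {η : Fin k → ℝ}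
    (h : ∏ i : Fin k, gDil k y (η i) ≠ 0) : ∑ i, |η i| ≤ 1 / 8 := by
  have hy0 : 0 < y := by linarith
  have hk : (0 : ℝ) < (k : ℝ) + 1 := by positivity
  calc ∑ i, |η i| ≤ ∑ _i : Fin k, 1 / (8 * ((k : ℝ) + 1)) :=
        Finset.sum_le_sum fun i _ ↦ (abs_le_of_prod_gDil_ne_zero hy0 h i).trans (yOne_div_le hy)
    _ = k * (1 / (8 * ((k : ℝ) + 1))) := by simp
    _ ≤ 1 / 8 := by
        rw [mul_one_div, div_le_div_iff₀ (by positivity) (by norm_num)]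
        nlinarith

/-- On the slice, `Φ_y(ξ(η)) = Π_i G(η_i)` (for `y ≥ 1`). [folklore] -/
theorem testPhi_slicePt {y : ℝ} (hy : 1 ≤ y) (η : Fin k → ℝ) :
    testPhi k y (slicePt η) = ∏ i : Fin k, gDil k y (η i) := by
  unfold testPhi
  have hsucc : ∀ i : Fin k, slicePt η i.succ = η i := fun i ↦ by simp [slicePt]
  simp_rw [hsucc]
  by_cases h : ∏ i : Fin k, gDil k y (η i) = 0
  · rw [h]; split_ifs <;> rfl
  · rw [if_pos]
    have h0 : slicePt η 0 = -∑ i, η i := by simp [slicePt]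
    rw [h0, abs_neg]
    refine (Finset.abs_sum_le_sum_abs _ _).trans ?_
    linarith [sum_abs_le_of_prod_gDil_ne_zero hy h]

/-- The box: `Φ_y(ξ) ≠ 0 ⟹ |ξ_j| ≤ 2` for all `j` (for `y ≥ 1`). [folklore] -/
theorem testPhi_box {y : ℝ} (hy : 1 ≤ y) (ξ : Fin (k + 1) → ℝ) (h : testPhi k y ξ ≠ 0) (j : Fin (k + 1)) :
    |ξ j| ≤ 2 := by
  unfold testPhi at h
  by_cases h0 : |ξ 0| ≤ 2
  · rw [if_pos h0] at h
    refine Fin.cases h0 (fun i ↦ ?_) j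
    have hy0 : 0 < y := by linarith
    have := abs_le_of_gDil_ne_zero k hy0 (Finset.prod_ne_zero_iff.1 h i (Finset.mem_univ i))
    refine this.trans ((yOne_div_le hy).trans ?_)
    rw [div_le_iff₀ (by positivity)]
    nlinarith [Nat.cast_nonneg (α := ℝ) k]
  · rw [if_neg h0] at h; exact absurd rfl h

/-- The slice support: `Φ_y(ξ(η)) ≠ 0 ⟹ Σ_j |ξ_j(η)| ≤ 1` (for `y ≥ 1`). [folklore] -/
theorem testPhi_sliceSupport {y : ℝ} (hy : 1 ≤ y) (η : Fin k → ℝ) (h : testPhi k y (slicePt η) ≠ 0) :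
    ∑ j, |slicePt η j| ≤ 2 - 1 := by
  rw [testPhi_slicePt hy] at h
  have hs := sum_abs_le_of_prod_gDil_ne_zero hy h
  rw [Fin.sum_univ_succ]
  have h0 : slicePt η 0 = -∑ i, η i := by simp [slicePt]
  have hsucc : ∀ i : Fin k, slicePt η i.succ = η i := fun i ↦ by simp [slicePt]
  simp_rw [hsucc, h0, abs_neg]
  linarith [Finset.abs_sum_le_sum_abs (fun i ↦ η i) Finset.univ]

/-- The sup bound `‖Φ_y‖ ≤ (s B_ψ)^k`. [folklore] -/
theorem norm_testPhi_le {y : ℝ} (hy : 0 < y) (ξ : Fin (k + 1) → ℝ) :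
    ‖testPhi k y ξ‖ ≤ (scl k y * psiBound) ^ k := by
  unfold testPhi
  split_ifs
  · rw [norm_prod]
    calc ∏ i : Fin k, ‖gDil k y (ξ i.succ)‖ ≤ ∏ _i : Fin k, scl k y * psiBound :=
          Finset.prod_le_prod (fun i _ ↦ norm_nonneg _) fun i _ ↦ norm_gDil_le k hy _
      _ = (scl k y * psiBound) ^ k := by simp
  · rw [norm_zero]; exact pow_nonneg (mul_nonneg (scl_pos k hy).le psiBound_nonneg) _

/-- `Φ_y ∘ ξ` is integrable on the slice. [folklore] -/
theorem integrable_testPhi_slicePt {y : ℝ} (hy : 1 ≤ y) :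
    Integrable fun η : Fin k → ℝ ↦ testPhi k y (slicePt η) := by
  simp_rw [testPhi_slicePt hy]
  have hy0 : 0 < y := by linarith
  exact Integrable.fintype_prod (f := fun (_ : Fin k) (t : ℝ) ↦ gDil k y t) fun _ ↦ integrable_gDil k hy0

/-- `∫ ‖Φ_y ∘ ξ‖ = (∫ ‖ψ‖)^k`. [folklore] -/
theorem integral_norm_testPhi_slicePt {y : ℝ} (hy : 1 ≤ y) :
    ∫ η : Fin k → ℝ, ‖testPhi k y (slicePt η)‖ = (∫ α, ‖psi α‖) ^ k := by
  have hy0 : 0 < y := by linarith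
  simp_rw [testPhi_slicePt hy, norm_prod]
  rw [integral_fintype_prod_volume_eq_prod (fun (_ : Fin k) (t : ℝ) ↦ ‖gDil k y t‖)]
  simp [integral_norm_gDil k hy0]

/-- **`f_{Φ_y}` is a product of Fejér factors**: `f_{Φ_y}(x) = Π_i ψ̂((x_{i+1} − x_0)/s)`.
[cite: RudnickSarnak1996, (3.6)] -/
theorem rsPhiTest_testPhi {y : ℝ} (hy : 1 ≤ y) (x : Fin (k + 1) → ℝ) :
    rsPhiTest (testPhi k y) x = ∏ i : Fin k, 𝓕 psi ((x i.succ - x 0) / scl k y) := by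
  have hy0 : 0 < y := by linarith
  unfold rsPhiTest
  have hslice : ∀ η : Fin k → ℝ, testPhi k y (Fin.cons (-∑ i, η i) η) = ∏ i : Fin k, gDil k y (η i) :=
    fun η ↦ testPhi_slicePt hy η
  simp_rw [hslice]
  have hexp : ∀ η : Fin k → ℝ, cexp (-(2 * π * I * ∑ i, ((x i.succ - x 0) * η i : ℝ))) =
      ∏ i : Fin k, cexp (-(2 * π * I * ((x i.succ - x 0) * η i : ℝ))) := by
    intro η
    rw [← Complex.exp_sum]
    congr 1
    rw [Complex.ofReal_sum, Finset.mul_sum, ← Finset.sum_neg_distrib]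
  simp_rw [hexp, ← Finset.prod_mul_distrib]
  rw [integral_fintype_prod_volume_eq_prod
    (fun (i : Fin k) (t : ℝ) ↦ gDil k y t * cexp (-(2 * π * I * ((x i.succ - x 0) * t : ℝ))))]
  exact Finset.prod_congr rfl fun i _ ↦ integral_gDil_mul_cexp k hy0 _

/-- `f_{Φ_y}(x)` is real and non-negative: its real part is `Π_i Re ψ̂(·) ≥ 0` and it equals its
real part. [folklore] -/
theorem rsPhiTest_testPhi_eq_re {y : ℝ} (hy : 1 ≤ y) (x : Fin (k + 1) → ℝ) :
    rsPhiTest (testPhi k y) x = ((∏ i : Fin k, (𝓕 psi ((x i.succ - x 0) / scl k y)).re : ℝ) : ℂ) := by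
  rw [rsPhiTest_testPhi hy, Complex.ofReal_prod]
  refine Finset.prod_congr rfl fun i _ ↦ Complex.ext ?_ ?_
  · simp
  · simp [psi_spec.2.2.1]

/-- `Π_i Re ψ̂(·) ≥ 0`. [folklore] -/
theorem rsPhiTest_testPhi_re_nonneg (y : ℝ) (x : Fin (k + 1) → ℝ) :
    0 ≤ ∏ i : Fin k, (𝓕 psi ((x i.succ - x 0) / scl k y)).re :=
  Finset.prod_nonneg fun _ _ ↦ psi_spec.2.2.2.1 _

/-- On the window `|x_{i+1} − x_0| ≤ y` (all `i`), `Re f_{Φ_y}(x) ≥ c^k`. [folklore] -/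
theorem pow_le_rsPhiTest_testPhi_re {y : ℝ} (hy : 1 ≤ y) {x : Fin (k + 1) → ℝ}
    (hx : ∀ i : Fin k, |x i.succ - x 0| ≤ y) :
    psiC ^ k ≤ ∏ i : Fin k, (𝓕 psi ((x i.succ - x 0) / scl k y)).re := by
  have hy0 : 0 < y := by linarith
  calc psiC ^ k = ∏ _i : Fin k, psiC := by simp
    _ ≤ ∏ i : Fin k, (𝓕 psi ((x i.succ - x 0) / scl k y)).re :=
        Finset.prod_le_prod (fun _ _ ↦ psiC_spec.1.le) fun i _ ↦ fourier_psi_div_re_ge k hy0 (hx i)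

/-! ## The clustered tuples and the lower bound for `W_{Φ_y}(T)` -/

/-- **The clustered `n`-tuples of zeros at height `T` and window `y`**: indices
`m = (m_0, …, m_k)` below `N(T + 3)` with `γ_{m_0} ≤ T` and `|γ_{m_i} − γ_{m_0}| ≤ 2πy/log T` for
`1 ≤ i ≤ k` (zeros counted with multiplicity). [cite: RudnickSarnak1996, (3.71)–(3.77)] -/
def clusterSet (k : ℕ) (T y : ℝ) : Finset (Fin (k + 1) → ℕ) :=
  (Fintype.piFinset fun _ : Fin (k + 1) ↦ Finset.range (zetaZeroCount (T + 3))).filter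
    (fun m ↦ zetaOrdinate (m 0) ≤ T ∧
      ∀ i : Fin k, |zetaOrdinate (m i.succ) - zetaOrdinate (m 0)| ≤ 2 * π * y / Real.log T)

/-- Membership in `clusterSet`. [folklore] -/
theorem mem_clusterSet {T y : ℝ} {m : Fin (k + 1) → ℕ} :
    m ∈ clusterSet k T y ↔ (∀ j, m j < zetaZeroCount (T + 3)) ∧ zetaOrdinate (m 0) ≤ T ∧
      ∀ i : Fin k, |zetaOrdinate (m i.succ) - zetaOrdinate (m 0)| ≤ 2 * π * y / Real.log T := by
  simp [clusterSet, Fintype.mem_piFinset]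

/-- `1 ≤ γ_n` (indeed `γ_n > 14`). [cite: Gram1903] -/
theorem one_le_zetaOrdinate (n : ℕ) : 1 ≤ zetaOrdinate n := by
  have h14 : 14 < zetaOrdinate n :=
    fourteen_lt_zetaOrdinate_zero_holds.trans_le (zetaOrdinate_mono_holds (Nat.zero_le n))
  linarith

/-- **Lower bound for the window of a clustered tuple**: if `1 ≤ γ_0 ≤ T` and all
`|γ_j − γ_0| ≤ 3`, then `K_T(γ) ≥ (κ(0)/2)^{n}` (integrate over `[γ_0 − 1, γ_0]`, where every
`|t − γ_j| ≤ 4` and `κ ≥ κ(0)/2`). [folklore] -/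
theorem pow_le_winKer {T : ℝ} {γ : Fin (k + 1) → ℝ} (h1 : 1 ≤ γ 0) (hT : γ 0 ≤ T)
    (hcl : ∀ j, |γ j - γ 0| ≤ 3) : (ker 0 / 2) ^ (k + 1) ≤ winKer T γ := by
  have hκ : 0 ≤ ker 0 / 2 := by linarith [ker_zero_pos]
  have hT0 : 0 ≤ T := by linarith
  unfold winKer
  have hii : ∀ a b : ℝ, IntervalIntegrable (fun t ↦ ∏ j, ker (t - γ j)) volume a b :=
    fun a b ↦ (continuous_prod_ker γ).intervalIntegrable a b
  -- restrict to `[γ_0 - 1, γ_0]`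
  have hsub : ∫ t in (γ 0 - 1)..(γ 0), ∏ j, ker (t - γ j) ≤ ∫ t in (0 : ℝ)..T, ∏ j, ker (t - γ j) :=
    intervalIntegral.integral_mono_interval (by linarith) (by linarith) hT
      (Eventually.of_forall fun t ↦ prod_ker_nonneg t γ) (hii 0 T)
  refine le_trans ?_ hsub
  -- pointwise lower bound on `[γ_0 - 1, γ_0]`
  have hpt : ∀ t ∈ Icc (γ 0 - 1) (γ 0), (ker 0 / 2) ^ (k + 1) ≤ ∏ j, ker (t - γ j) := by
    intro t ht
    rw [show (ker 0 / 2) ^ (k + 1) = ∏ _j : Fin (k + 1), ker 0 / 2 by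
      rw [Finset.prod_const, Finset.card_univ, Fintype.card_fin]]
    refine Finset.prod_le_prod (fun _ _ ↦ hκ) fun j _ ↦ half_ker_zero_le ?_
    have h1 : |t - γ 0| ≤ 1 := abs_le.2 ⟨by linarith [ht.1], by linarith [ht.2]⟩
    calc |t - γ j| = |(t - γ 0) - (γ j - γ 0)| := by ring_nf
      _ ≤ |t - γ 0| + |γ j - γ 0| := abs_sub _ _
      _ ≤ 1 + 3 := add_le_add h1 (hcl j)
      _ = 4 := by norm_num
  calc (ker 0 / 2) ^ (k + 1) = ∫ _t in (γ 0 - 1)..(γ 0), (ker 0 / 2) ^ (k + 1) := by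
        rw [intervalIntegral.integral_const]; simp
    _ ≤ ∫ t in (γ 0 - 1)..(γ 0), ∏ j, ker (t - γ j) :=
        intervalIntegral.integral_mono_on (by linarith) intervalIntegrable_const (hii _ _) hpt

/-- The summand of `W_{Φ_y}(T)` at the tuple `m`. [folklore] -/
def wTerm (k : ℕ) (y T : ℝ) (m : Fin (k + 1) → ℕ) : ℂ :=
  rsPhiTest (testPhi k y) (fun j ↦ Real.log T * zetaOrdinate (m j) / (2 * π)) * (winKer T (ordTuple m) : ℂ)

/-- The real factor of the summand. [folklore] -/
def wRe (k : ℕ) (y T : ℝ) (m : Fin (k + 1) → ℕ) : ℝ :=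
  (∏ i : Fin k, (𝓕 psi ((Real.log T * zetaOrdinate (m i.succ) / (2 * π) -
    Real.log T * zetaOrdinate (m 0) / (2 * π)) / scl k y)).re) * winKer T (ordTuple m)

/-- The summand is the real number `wRe`. [folklore] -/
theorem wTerm_eq {y : ℝ} (hy : 1 ≤ y) (T : ℝ) (m : Fin (k + 1) → ℕ) :
    wTerm k y T m = (wRe k y T m : ℂ) := by
  unfold wTerm wRe
  rw [rsPhiTest_testPhi_eq_re hy, ← Complex.ofReal_mul]

/-- `wRe ≥ 0` (for `T ≥ 0`). [folklore] -/
theorem wRe_nonneg (y : ℝ) {T : ℝ} (hT : 0 ≤ T) (m : Fin (k + 1) → ℕ) : 0 ≤ wRe k y T m := by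
  unfold wRe
  exact mul_nonneg (rsPhiTest_testPhi_re_nonneg (k := k) y (fun j ↦ Real.log T * zetaOrdinate (m j) / (2 * π)))
    (winKer_nonneg hT _)

/-- **Each clustered tuple contributes at least `c^k (κ(0)/2)^n`** (for `1 ≤ y`, `2πy ≤ 3 log T`).
[folklore] -/
theorem const_le_wRe {y T : ℝ} (hy : 1 ≤ y) (hyL : 2 * π * y ≤ 3 * Real.log T)
    {m : Fin (k + 1) → ℕ} (hm : m ∈ clusterSet k T y) :
    psiC ^ k * (ker 0 / 2) ^ (k + 1) ≤ wRe k y T m := by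
  rw [mem_clusterSet] at hm
  obtain ⟨-, hm0, hmi⟩ := hm
  have hL : 0 < Real.log T := by
    have : 2 * π * 1 ≤ 2 * π * y := by nlinarith [Real.pi_pos]
    nlinarith [Real.pi_gt_three]
  unfold wRe
  set x : Fin (k + 1) → ℝ := fun j ↦ Real.log T * zetaOrdinate (m j) / (2 * π) with hx
  refine mul_le_mul (pow_le_rsPhiTest_testPhi_re (x := x) hy fun i ↦ ?_)
    (pow_le_winKer (one_le_zetaOrdinate _) hm0 ?_)
    (pow_nonneg (by linarith [ker_zero_pos]) _) (rsPhiTest_testPhi_re_nonneg (k := k) y x)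
  · -- the window in normalised units
    simp only [hx]
    rw [← sub_div, ← mul_sub, abs_div, abs_mul, abs_of_pos hL, abs_of_pos (by positivity : (0 : ℝ) < 2 * π),
      div_le_iff₀ (by positivity)]
    have := hmi i
    rw [le_div_iff₀ hL] at this
    linarith
  · -- the cluster has diameter `≤ 3`
    intro j
    refine Fin.cases (by simp) (fun i ↦ ?_) j
    simp only [ordTuple]
    refine (hmi i).trans ?_
    rw [div_le_iff₀ hL]
    linarith

/-- **The lower bound**: `#clusterSet · c^k (κ(0)/2)^n ≤ ‖W_{Φ_y}(T)‖`. [folklore] -/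
theorem card_clusterSet_mul_le_norm_zeroSideSum {y T : ℝ} (hy : 1 ≤ y) (hT : 1 ≤ T)
    (hyL : 2 * π * y ≤ 3 * Real.log T) :
    (clusterSet k T y).card * (psiC ^ k * (ker 0 / 2) ^ (k + 1)) ≤ ‖zeroSideSum (testPhi k y) T‖ := by
  have hT0 : (0 : ℝ) ≤ T := by linarith
  have hsum : Summable (wTerm k y T) := summable_zeroSideSum_term (integrable_testPhi_slicePt hy) hT0
  have hW : zeroSideSum (testPhi k y) T = ∑' m, wTerm k y T m := rfl
  have hre : HasSum (fun m ↦ wRe k y T m) (zeroSideSum (testPhi k y) T).re := by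
    have h := Complex.hasSum_re hsum.hasSum
    rw [hW]
    refine h.congr_fun fun m ↦ ?_
    show wRe k y T m = (wTerm k y T m).re
    rw [wTerm_eq hy, Complex.ofReal_re]
  calc ((clusterSet k T y).card : ℝ) * (psiC ^ k * (ker 0 / 2) ^ (k + 1))
      = ∑ _m ∈ clusterSet k T y, psiC ^ k * (ker 0 / 2) ^ (k + 1) := by rw [Finset.sum_const, nsmul_eq_mul]
    _ ≤ ∑ m ∈ clusterSet k T y, wRe k y T m := Finset.sum_le_sum fun m hm ↦ const_le_wRe hy hyL hm
    _ ≤ (zeroSideSum (testPhi k y) T).re := sum_le_hasSum _ (fun m _ ↦ wRe_nonneg y hT0 m) hre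
    _ ≤ ‖zeroSideSum (testPhi k y) T‖ := Complex.re_le_norm _

/-! ## The cluster bound -/

/-- **Clustering of zeros at scale `1/log T`** (Rudnick–Sarnak 1996, p. 303, the `O(TL)` bound
for the majorant sums; RH): at level `n = k + 1` there are `C > 0` and `T₀` such that for all
`T ≥ T₀` and all `y` with `1 ≤ y` and `2πy ≤ 3 log T`,
`#{m : γ_{m_0} ≤ T, |γ_{m_i} − γ_{m_0}| ≤ 2πy/log T (1 ≤ i ≤ k)} ≤ C y^k T log T`.
[cite: RudnickSarnak1996, Thm. 3.2 (p. 303)] -/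
theorem exists_card_clusterSet_le (hRH : RiemannHypothesis) (k : ℕ) :
    ∃ C : ℝ, 0 < C ∧ ∀ T : ℝ, 3 ≤ T → ∀ y : ℝ, 1 ≤ y → 2 * π * y ≤ 3 * Real.log T →
      ((clusterSet k T y).card : ℝ) ≤ C * y ^ k * T * Real.log T := by
  obtain ⟨C₁, hC₁, hup⟩ := norm_zeroSideSum_le hRH k (δ := 1) one_pos
  obtain ⟨C₂, hC₂, herr⟩ := exists_errTerm_le k
  set c₀ : ℝ := psiC ^ k * (ker 0 / 2) ^ (k + 1)
  have hc₀ : 0 < c₀ := mul_pos (pow_pos psiC_spec.1 _) (pow_pos (by linarith [ker_zero_pos]) _)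
  set A : ℝ := unifConst k * (psiBound / yOne k) ^ k
  set B : ℝ := C₁ * C₂ * (∫ α, ‖psi α‖) ^ k
  have hA : 0 ≤ A := by
    have : 0 ≤ unifConst k := by
      unfold unifConst
      have := (densConst_pos k).le
      positivity
    have h2 : 0 ≤ psiBound / yOne k := div_nonneg psiBound_nonneg (yOne_pos k).le
    positivity
  have hB : 0 ≤ B := by
    have : 0 ≤ ∫ α, ‖psi α‖ := integral_nonneg fun _ ↦ norm_nonneg _
    positivity
  refine ⟨(A + B + 1) / c₀, div_pos (by linarith) hc₀, fun T hT y hy hyL ↦ ?_⟩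
  have hT1 : (1 : ℝ) ≤ T := by linarith
  have hT0 : (0 : ℝ) < T := by linarith
  have hy0 : 0 < y := by linarith
  have hL : 0 ≤ Real.log T := Real.log_nonneg hT1
  have hyk : 1 ≤ y ^ k := one_le_pow₀ hy
  -- upper bound
  have hU := hup T hT (testPhi k y) ((scl k y * psiBound) ^ k) (integrable_testPhi_slicePt hy)
    (norm_testPhi_le hy0) (fun ξ h ↦ testPhi_box hy ξ h) (fun η h ↦ testPhi_sliceSupport hy η h)
  rw [integral_norm_testPhi_slicePt hy] at hU
  have hscl : (scl k y * psiBound) ^ k = (psiBound / yOne k) ^ k * y ^ k := by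
    rw [← mul_pow]; congr 1; unfold scl; field_simp
  have hE := herr T hT
  have hU' : ‖zeroSideSum (testPhi k y) T‖ ≤ (A + B) * y ^ k * T * Real.log T := by
    refine hU.trans ?_
    rw [hscl]
    have h2 : C₁ * (Real.log T + k + 5) ^ (3 * (k + 1) + 1) * T ^ (1 - (1 : ℝ) / 2) * (∫ α, ‖psi α‖) ^ k ≤
        B * y ^ k * T * Real.log T := by
      have hI : 0 ≤ (∫ α, ‖psi α‖) ^ k := pow_nonneg (integral_nonneg fun _ ↦ norm_nonneg _) _
      calc C₁ * (Real.log T + k + 5) ^ (3 * (k + 1) + 1) * T ^ (1 - (1 : ℝ) / 2) * (∫ α, ‖psi α‖) ^ k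
          = C₁ * ((Real.log T + k + 5) ^ (3 * (k + 1) + 1) * T ^ (1 - (1 : ℝ) / 2)) * (∫ α, ‖psi α‖) ^ k := by ring
        _ ≤ C₁ * (C₂ * T * Real.log T) * (∫ α, ‖psi α‖) ^ k :=
            mul_le_mul_of_nonneg_right (mul_le_mul_of_nonneg_left hE hC₁) hI
        _ = B * 1 * T * Real.log T := by simp only [B]; ring
        _ ≤ B * y ^ k * T * Real.log T := by gcongr
    have h1 : unifConst k * ((psiBound / yOne k) ^ k * y ^ k) * T * Real.log T = A * y ^ k * T * Real.log T := by
      simp only [A]; ring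
    linarith
  -- lower bound and conclusion
  have hLB := card_clusterSet_mul_le_norm_zeroSideSum (k := k) hy hT1 hyL
  have hfin : ((clusterSet k T y).card : ℝ) * c₀ ≤ (A + B + 1) * y ^ k * T * Real.log T := by
    refine hLB.trans (hU'.trans ?_)
    have : 0 ≤ y ^ k * T * Real.log T := by positivity
    nlinarith
  rw [div_mul_eq_mul_div, div_mul_eq_mul_div, div_mul_eq_mul_div, le_div_iff₀ hc₀]
  exact hfin

end Unsmooth

end RudnickSarnakN

end Literature.NumberTheory.LFunctions

end
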